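import Summits.QuantumFields.YangMills.Theorems.BalabanUVNodesN21FirstExceedanceHazard

/-!
# N21 (NE7c) · the windowed hazard bound from LOCAL NON-COLLAPSE of a density — in particular from a one-sided
# log-Lipschitz bound — and (M1) for a block-sup with constant `e·Λ·θ`

R134 seat pub-ymgap-dag-n21-d (g8), node N21 = NE7c (single-run shell-weight bound, NOT PRINTED in [Bałaban 1983–89],
NOT proved), lane K3⁷ `SpineGivenEndpointR13SepCoPH` (stmt-QuantumFields-20544, `--kind proof --supports … --as helper`).
Part 8 of the comparison series; consumes part 7 (`…N21FirstExceedanceHazard`: the dependent hazard principle).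

WHAT THIS FILE IS.  Part 7 reduced (M1) for a block-sup (uniformly in the number of tested variables) to a WINDOWED
HAZARD BOUND per variable, `μ[a, b) ≤ c · μ[a, ∞)`, and verified it for Gaussians via Mills' ratio.  This file gives the
Gaussian-free ONE-DIMENSIONAL DEVICE producing such a bound — the relative sibling of `T4ShellMeasure`'s device (b)
(`measure_preimage_window_le`: a density BOUND gives an ABSOLUTE window bound):

* §1 LOCAL NON-COLLAPSE ⇒ HAZARD.  If a density `f` on `ℝ` satisfies `f(x) ≤ M · f(y)` for `x ∈ [a, b)` and
  `y ∈ [x, x + δ]` (it does not DROP by more than the factor `M` within distance `δ` to the right of the window), then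
  `∫_{[a,b)} f ≤ M·(b − a)∕δ · ∫_{[a, b+δ]} f` (`setLIntegral_Ico_le_of_nonCollapse`): each value `f(x)` is dominated by
  `M∕δ ×` the mass just to its right.  Measure form for `volume.withDensity f` (§2): the windowed hazard bound with
  `c = M(b − a)∕δ`, relative to `[a, b + δ]`, a fortiori to `[a, ∞)`.
* §3 ONE-SIDED LOG-LIPSCHITZ ⇒ NON-COLLAPSE.  For `f = e^{−W}` with `W(y) − W(x) ≤ Λ(y − x)` (`x ≤ y` in the
  enlarged window) one has `M = e^{Λδ}`; the choice `δ = Λ⁻¹` gives the hazard constant `c = e·Λ·(b − a)`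
  (`withDensity_exp_neg_Ico_le_of_logLipschitz`).
* §4 KNIT WITH PART 7.  Independent coordinates whose laws have densities `e^{−W_p}`, each `W_p` with slope `≤ Λ`
  above the shell `[θ(1−ρ), θ]` (on `[θ(1−ρ), θ + Λ⁻¹]`), give `T4ShellMeasure.SlotAntiConcentration` for the maximum
  coordinate with constant `D = e·Λ·θ` — NO Gaussian comparison, NO dependence on the number of coordinates
  (`slotAntiConcentration_iSup_pi_of_logLipschitz`); general non-collapse version `D = M·θ∕δ`.

READING FOR THE WALL (lens Card 36 ∕ 51, parts 6–7 continued; nothing of this is claimed for Bałaban's measure).  For a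
Gibbs-type fibre density `∝ e^{−A}` of one tested variable, `Λ·θ` is the number of e-folds the density drops per
threshold-width just above the threshold — for a quadratic small-field action read at `x` standard deviations this is
`≈ x²`, the polylogarithmic profile `x_j²` of lens Card 51 (K-uniform on the live window, absorbed by ROW T's
`…LevelLedgerLinearGrowth.shellWeightBound_of_levels_summable`), now WITHOUT the Gaussian model: the input is a
one-sided SLOPE bound of the fibre action across one shell width, conditional on sub-level events of the other
variables (part 7 §2), not a density comparison.

HONEST FRAMING.  [textbook] real analysis (translation invariance of Lebesgue measure + monotonicity of the integral);
0 def, 0 sorry; the product structure of §4 is the MODEL's assumption; the conditional slope bound for the (2.18) fibre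
law is NOT claimed; NE7c NOT PRINTED ∕ NOT proved; N21 NOT discharged; counts unmoved (typed 28∕28 · discharged 5∕27);
count-neutral; one finite 𝕋⁴ at fixed ε — nothing about ℝ⁴ ∕ OS ∕ mass gap ∕ Clay.
-/

open MeasureTheory Set
open scoped ENNReal NNReal

namespace Summit.QuantumFields.YangMills.Theorems.N21HazardFromLogLipschitz

open Literature.MathematicalPhysics.QuantumFieldTheory.Balaban1983to89.T4ShellMeasure (SlotAntiConcentration)
open Summit.QuantumFields.YangMills.Theorems.N21FirstExceedanceHazard
  (slotAntiConcentration_iSup_pi_of_hazard measure_shell_iSup_pi_le_of_hazard)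

/-! ## §1 Local non-collapse of a density ⇒ the window integral is dominated by the mass to its right -/

/-- **LOCAL NON-COLLAPSE ⇒ WINDOWED HAZARD (integral form).**  `f(x) ≤ M·f(y)` for `x ∈ [a, b)`, `y ∈ [x, x + δ]`
(`δ > 0`) ⇒ `∫_{[a,b)} f ≤ M · (b − a)∕δ · ∫_{[a, b+δ]} f` (Lebesgue measure). [textbook] -/
theorem setLIntegral_Ico_le_of_nonCollapse {f : ℝ → ℝ≥0∞} (hf : Measurable f) {a b δ : ℝ}
    (hδ : 0 < δ) (M : ℝ≥0∞) (h : ∀ x ∈ Ico a b, ∀ y ∈ Icc x (x + δ), f x ≤ M * f y) :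
    ∫⁻ x in Ico a b, f x ≤ M * ENNReal.ofReal ((b - a) / δ) * ∫⁻ y in Icc a (b + δ), f y := by
  set I := ∫⁻ y in Icc a (b + δ), f y with hI
  have hδ0 : ENNReal.ofReal δ ≠ 0 := (ENNReal.ofReal_pos.2 hδ).ne'
  have hδtop : ENNReal.ofReal δ ≠ ⊤ := ENNReal.ofReal_ne_top
  -- pointwise: `δ · f(x) ≤ M · I`
  have hpt : ∀ x ∈ Ico a b, f x ≤ (ENNReal.ofReal δ)⁻¹ * (M * I) := by
    intro x hx
    have hsub : Icc x (x + δ) ⊆ Icc a (b + δ) := Icc_subset_Icc hx.1 (by linarith [hx.2])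
    have h1 : ENNReal.ofReal δ * f x ≤ M * I := by
      calc ENNReal.ofReal δ * f x = ∫⁻ _ in Icc x (x + δ), f x := by
            rw [setLIntegral_const, Real.volume_Icc, mul_comm]
            congr 2
            ring
        _ ≤ ∫⁻ y in Icc x (x + δ), M * f y := setLIntegral_mono' measurableSet_Icc fun y hy => h x hx y hy
        _ = M * ∫⁻ y in Icc x (x + δ), f y := lintegral_const_mul M hf
        _ ≤ M * I := mul_le_mul_right (lintegral_mono_set hsub) _
    calc f x = (ENNReal.ofReal δ)⁻¹ * (ENNReal.ofReal δ * f x) := by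
          rw [← mul_assoc, ENNReal.inv_mul_cancel hδ0 hδtop, one_mul]
      _ ≤ (ENNReal.ofReal δ)⁻¹ * (M * I) := mul_le_mul_right h1 _
  calc ∫⁻ x in Ico a b, f x ≤ ∫⁻ _ in Ico a b, (ENNReal.ofReal δ)⁻¹ * (M * I) :=
        setLIntegral_mono' measurableSet_Ico hpt
    _ = (ENNReal.ofReal δ)⁻¹ * (M * I) * ENNReal.ofReal (b - a) := by rw [setLIntegral_const, Real.volume_Ico]
    _ = M * ENNReal.ofReal ((b - a) / δ) * I := by
        rw [ENNReal.ofReal_div_of_pos hδ, div_eq_mul_inv]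
        ring

/-! ## §2 Measure form: the windowed hazard bound for `volume.withDensity f` -/

/-- **LOCAL NON-COLLAPSE ⇒ WINDOWED HAZARD (measure form).**  For the law `volume.withDensity f`:
`μ[a, b) ≤ M(b − a)∕δ · μ[a, b + δ]`. [textbook] -/
theorem withDensity_Ico_le_Icc_of_nonCollapse {f : ℝ → ℝ≥0∞} (hf : Measurable f) {a b δ : ℝ}
    (hδ : 0 < δ) (M : ℝ≥0∞) (h : ∀ x ∈ Ico a b, ∀ y ∈ Icc x (x + δ), f x ≤ M * f y) :
    volume.withDensity f (Ico a b)
      ≤ M * ENNReal.ofReal ((b - a) / δ) * volume.withDensity f (Icc a (b + δ)) := by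
  rw [withDensity_apply _ measurableSet_Ico, withDensity_apply _ measurableSet_Icc]
  exact setLIntegral_Ico_le_of_nonCollapse hf hδ M h

/-- … a fortiori relative to the whole exceedance event: `μ[a, b) ≤ M(b − a)∕δ · μ[a, ∞)` — the hypothesis shape of
part 7 §3 (`measure_shell_iSup_pi_le_of_hazard`) with `c = M(b − a)∕δ`. [textbook] -/
theorem withDensity_Ico_le_Ici_of_nonCollapse {f : ℝ → ℝ≥0∞} (hf : Measurable f) {a b δ : ℝ}
    (hδ : 0 < δ) (M : ℝ≥0∞) (h : ∀ x ∈ Ico a b, ∀ y ∈ Icc x (x + δ), f x ≤ M * f y) :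
    volume.withDensity f (Ico a b) ≤ M * ENNReal.ofReal ((b - a) / δ) * volume.withDensity f (Ici a) :=
  (withDensity_Ico_le_Icc_of_nonCollapse hf hδ M h).trans
    (mul_le_mul_right (measure_mono fun _ hy => hy.1) _)

/-! ## §3 One-sided log-Lipschitz densities `e^{−W}` -/

/-- a one-sided slope bound `W(y) − W(x) ≤ Λ(y − x)` on `x ≤ y ≤ x + δ`, `x ∈ S` (`Λ ≥ 0`; `S` any set — a window
`[a, b)` below) is local non-collapse of `e^{−W}` on `S` with factor `e^{Λδ}`. [textbook] -/
theorem nonCollapse_of_logLipschitz {W : ℝ → ℝ} {S : Set ℝ} {δ Λ : ℝ} (hΛ : 0 ≤ Λ)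
    (hW : ∀ x ∈ S, ∀ y ∈ Icc x (x + δ), W y - W x ≤ Λ * (y - x)) :
    ∀ x ∈ S, ∀ y ∈ Icc x (x + δ),
      ENNReal.ofReal (Real.exp (-W x)) ≤ ENNReal.ofReal (Real.exp (Λ * δ)) * ENNReal.ofReal (Real.exp (-W y)) := by
  intro x hx y hy
  rw [← ENNReal.ofReal_mul (Real.exp_pos _).le, ← Real.exp_add]
  refine ENNReal.ofReal_le_ofReal (Real.exp_le_exp.2 ?_)
  have h1 := hW x hx y hy
  have h2 : Λ * (y - x) ≤ Λ * δ := mul_le_mul_of_nonneg_left (by linarith [hy.2]) hΛ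
  linarith

/-- **ONE-SIDED LOG-LIPSCHITZ ⇒ WINDOWED HAZARD.**  For the law with density `e^{−W}`, `W` measurable with slope `≤ Λ`
(`Λ > 0`) to the right on `[a, b + Λ⁻¹]`: `μ[a, b) ≤ e·Λ·(b − a) · μ[a, ∞)` (§2 at `δ = Λ⁻¹`, `M = e`). [textbook] -/
theorem withDensity_exp_neg_Ico_le_of_logLipschitz {W : ℝ → ℝ} (hWm : Measurable W) {a b Λ : ℝ}
    (hΛ : 0 < Λ) (hW : ∀ x ∈ Ico a b, ∀ y ∈ Icc x (x + Λ⁻¹), W y - W x ≤ Λ * (y - x)) :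
    volume.withDensity (fun x => ENNReal.ofReal (Real.exp (-W x))) (Ico a b)
      ≤ ENNReal.ofReal (Real.exp 1 * Λ * (b - a))
        * volume.withDensity (fun x => ENNReal.ofReal (Real.exp (-W x))) (Ici a) := by
  have hf : Measurable fun x => ENNReal.ofReal (Real.exp (-W x)) :=
    ENNReal.measurable_ofReal.comp (Real.measurable_exp.comp hWm.neg)
  have h := withDensity_Ico_le_Ici_of_nonCollapse hf (inv_pos.2 hΛ) (ENNReal.ofReal (Real.exp (Λ * Λ⁻¹)))
    (nonCollapse_of_logLipschitz hΛ.le hW)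
  rw [mul_inv_cancel₀ hΛ.ne', ← ENNReal.ofReal_mul (Real.exp_pos _).le] at h
  convert h using 3
  rw [div_eq_mul_inv, inv_inv]
  ring

/-! ## §4 Knit with part 7: (M1) for the maximum of independent coordinates, constant `M·θ∕δ` ∕ `e·Λ·θ` -/

section Knit

variable {ι : Type*} [Fintype ι] [DecidableEq ι] [Nonempty ι]

/-- **(M1) FROM LOCAL NON-COLLAPSE, `n`-FREE.**  Independent coordinates with laws `volume.withDensity (f p)`, each
density non-collapsing by the factor `M ≥ 0` within `δ > 0` to the right on the window `[θ(1−ρ), θ)` (σ-finite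
laws), give
`T4ShellMeasure.SlotAntiConcentration (Measure.pi …) (x ↦ ⨆ p, x p) θ ρ (M·θ∕δ)`, whatever the number of coordinates
(part 7's `slotAntiConcentration_iSup_pi_of_hazard` + §2). [textbook] -/
theorem slotAntiConcentration_iSup_pi_of_nonCollapse {f : ι → ℝ → ℝ≥0∞} (hf : ∀ p, Measurable (f p))
    [∀ p, SigmaFinite (volume.withDensity (f p))] {θ ρ δ M : ℝ} (hδ : 0 < δ) (hM : 0 ≤ M)
    (h : ∀ p, ∀ x ∈ Ico (θ * (1 - ρ)) θ, ∀ y ∈ Icc x (x + δ), f p x ≤ ENNReal.ofReal M * f p y) :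
    SlotAntiConcentration (Measure.pi fun p => volume.withDensity (f p)) (fun x => ⨆ p, x p) θ ρ (M * θ / δ) := by
  refine slotAntiConcentration_iSup_pi_of_hazard (fun p => volume.withDensity (f p)) fun p => ?_
  refine (withDensity_Ico_le_Ici_of_nonCollapse (hf p) hδ (ENNReal.ofReal M) (h p)).trans (le_of_eq ?_)
  rw [← ENNReal.ofReal_mul hM]
  congr 2
  field_simp
  ring

/-- **(M1) FROM A ONE-SIDED LOG-LIPSCHITZ BOUND, constant `e·Λ·θ`.**  Independent coordinates with densities `e^{−W_p}`,
each `W_p` measurable with slope `≤ Λ` (`Λ > 0`) to the right on `[θ(1−ρ), θ + Λ⁻¹]`, give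
`T4ShellMeasure.SlotAntiConcentration (Measure.pi …) (x ↦ ⨆ p, x p) θ ρ (e·Λ·θ)` — no Gaussian comparison, no dependence
on the number of coordinates. [textbook] -/
theorem slotAntiConcentration_iSup_pi_of_logLipschitz {W : ι → ℝ → ℝ} (hWm : ∀ p, Measurable (W p))
    {θ ρ Λ : ℝ} (hΛ : 0 < Λ)
    (hW : ∀ p, ∀ x ∈ Ico (θ * (1 - ρ)) θ, ∀ y ∈ Icc x (x + Λ⁻¹), W p y - W p x ≤ Λ * (y - x)) :
    SlotAntiConcentration (Measure.pi fun p => volume.withDensity fun x => ENNReal.ofReal (Real.exp (-W p x)))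
      (fun x => ⨆ p, x p) θ ρ (Real.exp 1 * Λ * θ) := by
  refine slotAntiConcentration_iSup_pi_of_hazard
    (fun p => volume.withDensity fun x => ENNReal.ofReal (Real.exp (-W p x))) fun p => ?_
  refine (withDensity_exp_neg_Ico_le_of_logLipschitz (hWm p) hΛ (hW p)).trans (le_of_eq ?_)
  congr 2
  ring

/-- the relative form behind the two corollaries: `P(θ(1−ρ) ≤ max < θ) ≤ e·Λ·θρ · P(max ≥ θ(1−ρ))`
(part 7's `measure_shell_iSup_pi_le_of_hazard` + §3). [textbook] -/
theorem measure_shell_iSup_pi_le_of_logLipschitz {W : ι → ℝ → ℝ} (hWm : ∀ p, Measurable (W p))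
    {θ ρ Λ : ℝ} (hΛ : 0 < Λ)
    (hW : ∀ p, ∀ x ∈ Ico (θ * (1 - ρ)) θ, ∀ y ∈ Icc x (x + Λ⁻¹), W p y - W p x ≤ Λ * (y - x)) :
    Measure.pi (fun p => volume.withDensity fun x => ENNReal.ofReal (Real.exp (-W p x)))
        {x : ι → ℝ | θ * (1 - ρ) ≤ (⨆ p, x p) ∧ (⨆ p, x p) < θ}
      ≤ ENNReal.ofReal (Real.exp 1 * Λ * θ * ρ) *
        Measure.pi (fun p => volume.withDensity fun x => ENNReal.ofReal (Real.exp (-W p x)))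
          {x | θ * (1 - ρ) ≤ ⨆ p, x p} := by
  have h : ∀ p, (volume.withDensity fun x => ENNReal.ofReal (Real.exp (-W p x))) (Ico (θ * (1 - ρ)) θ)
      ≤ ENNReal.ofReal (Real.exp 1 * Λ * θ * ρ)
        * (volume.withDensity fun x => ENNReal.ofReal (Real.exp (-W p x))) (Ici (θ * (1 - ρ))) := fun p => by
    have h1 := withDensity_exp_neg_Ico_le_of_logLipschitz (hWm p) hΛ (hW p)
    rwa [show Real.exp 1 * Λ * (θ - θ * (1 - ρ)) = Real.exp 1 * Λ * θ * ρ by ring] at h1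
  exact measure_shell_iSup_pi_le_of_hazard _ _ h

end Knit

end Summit.QuantumFields.YangMills.Theorems.N21HazardFromLogLipschitz
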